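import Mathlib
import Summits.ValiantsHypothesis.ValiantsHypothesis.Theorems.NewtonTauWeak.Negative.Zonogon
import Summits.ValiantsHypothesis.ValiantsHypothesis.Theorems.NewtonUnitEquationsNewtonTauWeakGradedDesignT2

/-!
# `NewtonUnitEquationsNewtonTauWeakLevelSetOfT2` — the level-set reduction: the binomial T2 bound controls every weighted level set

Registered stub `stub_levelSetOfT2` of line `binomial-normal-form` (crux `NewtonTauWeak`, stmt-ValiantsHypothesis-5904, lead c6,
namespace `RungC6` of `Cruxes/NewtonTauWeak/Lines/binomial_normal_form.lean`, wave 2).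

Setting.  A dissociated exponent list `d j ∈ ℕ²` (`j : Fin N`; all subset sums distinct), a grading `g j ∈ ℕ`
and a level `v ∈ ℕ`; the *weighted level set* is `X_v = {Σ_{j∈J} d_j : Σ_{j∈J} g_j = v} ⊆ ℕ²`.  The hypothesis
`hT2` is the binomial normal form inequality T2 with a FIXED exponent `b`: a sum of `K` scalar multiples of
products of `N` binomials `1 − ρ_{lj} X^{d_j}` over a common exponent list has at most `(K N + 2)^b` Newton
vertices.

Claim (necessity half of the level-set dichotomy).  `#ext conv X_v ≤ ((Σ_j g_j + 1) N + 2)^b`.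

Proof.  Put `K = Σ_j g_j + 1` and take the `K` distinct nodes `u_l = l + 1 ∈ ℂ` (`l < K`).
* (`LevelSetOfT2Aux.exists_dual_interpolation`)  The Vandermonde matrix `(u_l^s)_{l,s<K}` is invertible, so
  there are weights `cf_l` with `F(s) := Σ_l cf_l u_l^s = [s = v]` for every `s < K` (solve the transposed
  Vandermonde system with the nonsingular inverse).
* (`LevelSetOfT2Aux.support_isolating_design`)  For the graded design
  `f = Σ_{l<K} cf_l Π_j (1 − u_l^{g_j} X^{d_j})` the coefficient at a subset sum `Σ_J d` is
  `(−1)^{|J|} F(Σ_J g_j)` (`GradedDesignT2Aux.coeff_graded_subsetSum`, dissociation), and every other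
  coefficient vanishes (`GradedDesignT2Aux.coeff_graded`); since every `Σ_J g_j < K`, the support of `f` is
  EXACTLY the level set `X_v` (empty if `v > Σ_j g_j`, where `f = 0`).
* Hence `#ext conv X_v = vert f ≤ (K N + 2)^b` by `hT2`.

Everything is folklore (Vandermonde invertibility, expansion of binomial products); no named facts, no
citations, no `def`s.
-/

-- Sub = Summit single-conjunct layout: the duplicated namespace component is mandated by the tree.
set_option linter.dupNamespace false

noncomputable section

open scoped BigOperators
open MvPolynomial
open Summit.ValiantsHypothesis.ValiantsHypothesis.Theorems.NewtonTauWeak.Negative (vert)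

namespace Summit.ValiantsHypothesis.ValiantsHypothesis.Theorems.NewtonUnitEquationsNewtonTauWeak

namespace LevelSetOfT2Aux

/-- **Dual interpolation at distinct nodes.**  For `K` distinct nodes `u_l` and any target values `δ_s`
(`s < K`) there are weights `cf_l` with `Σ_l cf_l u_l^s = δ_s` for all `s < K`: the Vandermonde matrix
`V = (u_l^s)` has nonzero determinant, and `cf = δ V⁻¹` solves `cf V = δ`. [folklore] -/
theorem exists_dual_interpolation {K : ℕ} (u : Fin K → ℂ) (hu : Function.Injective u) (δ : Fin K → ℂ) :
    ∃ cf : Fin K → ℂ, ∀ s : Fin K, ∑ l, cf l * u l ^ (s : ℕ) = δ s := by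
  have hdet : IsUnit (Matrix.vandermonde u).det :=
    isUnit_iff_ne_zero.mpr (Matrix.det_vandermonde_ne_zero_iff.mpr hu)
  refine ⟨Matrix.vecMul δ (Matrix.vandermonde u)⁻¹, fun s => ?_⟩
  have h : Matrix.vecMul (Matrix.vecMul δ (Matrix.vandermonde u)⁻¹) (Matrix.vandermonde u) = δ := by
    rw [Matrix.vecMul_vecMul, Matrix.nonsing_inv_mul _ hdet, Matrix.vecMul_one]
  have hs := congrFun h s
  simpa only [Matrix.vecMul, dotProduct, Matrix.vandermonde_apply] using hs

/-- **Support of a level-isolating graded design.**  On a dissociated frame `d`, if the exponential polynomial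
`F(s) = Σ_l cf_l u_l^s` of the weights satisfies `F(Σ_J g_j) = [Σ_J g_j = v]` for every `J`, then the graded
design `f = Σ_l cf_l Π_j (1 − u_l^{g_j} ρ_j X^{d_j})` (`ρ_j ≠ 0`) has support EXACTLY the weighted level set
`X_v = {Σ_J d : Σ_J g = v}`: at `Σ_J d` the coefficient is `Π_{j∈J} (−ρ_j) · F(Σ_J g_j)`
(`GradedDesignT2Aux.coeff_graded_subsetSum`), and off the subset sums every expanded summand vanishes
(`GradedDesignT2Aux.coeff_graded`). [folklore] -/
theorem support_isolating_design {N K : ℕ} (g : Fin N → ℕ) (u cf : Fin K → ℂ) (ρ : Fin N → ℂ)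
    (hρ : ∀ j, ρ j ≠ 0) (d : Fin N → (Fin 2 →₀ ℕ)) (v : ℕ)
    (hdis : ∀ J J' : Finset (Fin N), ∑ j ∈ J, d j = ∑ j ∈ J', d j → J = J')
    (hF : ∀ J : Finset (Fin N),
      ∑ l, cf l * u l ^ (∑ j ∈ J, g j) = if ∑ j ∈ J, g j = v then 1 else 0) :
    (∑ l, C (cf l) * ∏ j, (1 - C (u l ^ g j * ρ j) * monomial (d j) 1)).support =
      (Finset.univ.filter fun J : Finset (Fin N) => ∑ j ∈ J, g j = v).image fun J => ∑ j ∈ J, d j := by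
  have hprod : ∀ J : Finset (Fin N), ∏ j ∈ J, -ρ j ≠ 0 := fun J =>
    Finset.prod_ne_zero_iff.mpr fun j _ => neg_ne_zero.mpr (hρ j)
  ext e
  simp only [mem_support_iff, Finset.mem_image, Finset.mem_filter, Finset.mem_univ, true_and]
  constructor
  · intro he
    by_cases hex : ∃ J : Finset (Fin N), ∑ j ∈ J, d j = e
    · obtain ⟨J, rfl⟩ := hex
      rw [GradedDesignT2Aux.coeff_graded_subsetSum g u cf ρ d hdis J, hF J] at he
      refine ⟨J, ?_, rfl⟩
      by_contra hJ
      exact he (by rw [if_neg hJ, mul_zero])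
    · refine absurd ?_ he
      rw [GradedDesignT2Aux.coeff_graded]
      exact Finset.sum_eq_zero fun l _ => Finset.sum_eq_zero fun T _ => if_neg fun hT => hex ⟨T, hT⟩
  · rintro ⟨J, hJ, rfl⟩
    rw [GradedDesignT2Aux.coeff_graded_subsetSum g u cf ρ d hdis J, hF J, if_pos hJ, mul_one]
    exact hprod J

end LevelSetOfT2Aux

/-- **The level-set reduction (necessity half of the dichotomy).**  If the binomial normal form inequality T2
holds with exponent `b` — every sum of `K` scalar multiples of products of `N` binomials `1 − ρ_{lj} X^{d_j}`
over a common exponent list has at most `(K N + 2)^b` Newton vertices — then on a dissociated exponent list `d`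
every weighted level set `X_v = {Σ_J d_j : Σ_J g_j = v}` has at most `((Σ_j g_j + 1) N + 2)^b` hull vertices.
Proof: with `K = Σ_j g_j + 1` distinct nodes `u_l = l + 1` and weights `cf = δ_v V⁻¹` from the inverse
Vandermonde matrix, `Σ_l cf_l u_l^s = [s = v]` for all `s < K`, so the graded design
`Σ_l cf_l Π_j (1 − u_l^{g_j} X^{d_j})` has support exactly `X_v`, and `hT2` bounds its vertex count.
[folklore] -/
theorem stub_levelSetOfT2 (b : ℕ)
    (hT2 : ∀ (K N : ℕ) (c : Fin K → ℂ) (ρ : Fin K → Fin N → ℂ) (d : Fin N → (Fin 2 →₀ ℕ)),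
      vert (∑ l, C (c l) * ∏ j, (1 - C (ρ l j) * monomial (d j) 1)) ≤ (K * N + 2) ^ b)
    (N v : ℕ) (g : Fin N → ℕ) (d : Fin N → (Fin 2 →₀ ℕ))
    (hdis : ∀ J J' : Finset (Fin N), ∑ j ∈ J, d j = ∑ j ∈ J', d j → J = J') :
    (Set.extremePoints ℝ (convexHull ℝ ((fun e : Fin 2 →₀ ℕ => fun i : Fin 2 => ((e i : ℕ) : ℝ)) ''
      (((Finset.univ.filter fun J : Finset (Fin N) => ∑ j ∈ J, g j = v).image
        fun J => ∑ j ∈ J, d j : Finset (Fin 2 →₀ ℕ)) : Set (Fin 2 →₀ ℕ))))).ncard ≤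
      ((∑ j, g j + 1) * N + 2) ^ b := by
  -- `K = Σ_j g_j + 1` distinct nodes `u_l = l + 1`.
  have hu : Function.Injective fun l : Fin (∑ j, g j + 1) => ((l : ℕ) : ℂ) + 1 := fun l l' h =>
    Fin.ext (Nat.cast_injective (R := ℂ) (add_right_cancel h))
  -- Weights isolating the level `v`: `Σ_l cf_l u_l^s = [s = v]` for all `s < K`.
  obtain ⟨cf, hcf⟩ := LevelSetOfT2Aux.exists_dual_interpolation _ hu
    fun s => if (s : ℕ) = v then 1 else 0
  have hF : ∀ J : Finset (Fin N), ∑ l, cf l * (((l : ℕ) : ℂ) + 1) ^ (∑ j ∈ J, g j) =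
      if ∑ j ∈ J, g j = v then 1 else 0 := fun J =>
    hcf ⟨∑ j ∈ J, g j, Nat.lt_succ_of_le (Finset.sum_le_univ_sum_of_nonneg fun _ => Nat.zero_le _)⟩
  -- T2 for the level-isolating graded design, whose support is exactly `X_v`.
  have key : vert (∑ l, C (cf l) * ∏ j, (1 - C ((((l : ℕ) : ℂ) + 1) ^ g j * 1) * monomial (d j) 1)) ≤
      ((∑ j, g j + 1) * N + 2) ^ b :=
    hT2 (∑ j, g j + 1) N cf (fun l j => (((l : ℕ) : ℂ) + 1) ^ g j * 1) d
  unfold vert at key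
  rwa [LevelSetOfT2Aux.support_isolating_design g _ cf (fun _ => 1) (fun _ => one_ne_zero) d v hdis hF]
    at key

end Summit.ValiantsHypothesis.ValiantsHypothesis.Theorems.NewtonUnitEquationsNewtonTauWeak

end
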